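import Mathlib
import Literature.Computability.AlgebraicComplexity.ChartUSP
import Literature.Computability.AlgebraicComplexity.SimultaneousDoubleProduct

/-!
# Rows of a local chart-USP from corner-free squares — stub `stub_rowsDesign` of line
`registered` (clustered-charts reshape; crux `EisensteinValCertificates.HomocyclicSTPPDesigns`,
stmt-MatrixMultiplication-10647)

The line's new combinatorial theorem.  Data: an SDPP family `(A_i, B_i)_{i<n}` in `ℤ/p` (tree
`IsSDPP`) with `|A_i| = a`, `|B_i| = b`, a class map `cls : Fin n → Fin m` whose classes have
pairwise DISJOINT difference sets `A_i − B_i` and at least `d ≥ 1` members each, a width `t` and a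
corner-free set `S ⊆ (ℤ/d^t)²` (no `(x, y), (x + δ, y), (x + δ, y − δ)` with `δ ≠ 0`).  Conclusion:
an STPP family (tree `IsSTPP`) of `L ≥ m^{3t}·|S|` triples in `(ℤ/p)^{3t}`, every block of volume
`(ab)^{3t}`.

Construction (Cohn–Kleinberg–Szegedy–Umans 2005, Def. 36 / Thm. 37 = tree
`CohnKleinbergSzegedyUmans2005_thm37`, over the chart of §6.2): symbols `(i, r) ∈ Fin n × Fin 3`,
role `0 ↦ (A_i, B_i, {0})`, role `1 ↦ ({0}, A_i, B_i)`, role `2 ↦ (B_i, {0}, A_i)` — an `H`-chart by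
clause (W) of the SDPP.  Rows are indexed by a class word `κ : Fin (3t) → Fin m` and a pair
`s = (X, Y) ∈ S`; coordinate `c ↔ (r, τ) ∈ Fin 3 × Fin t` carries role `r` (for every row) and the
symbol `mem (κ c) (digit_τ (V_r s))`, where `V_0 s = X`, `V_1 s = Y`, `V_2 s = −X−Y`,
`digit : ℤ/d^t ≃ (Fin t → Fin d)` and `mem c : Fin d ↪ cls⁻¹(c)`.  The hypothesis of the theorem
(the neighbouring stub `stub_chartPattern`) says that a same-role symbol triple OUTSIDE the chart
hypergraph has two equal indices and two meeting difference sets; with the clustering this forces,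
for an index triple `(u, v, w)` bad at every coordinate, equal class words and
`X_u = X_w`, `Y_v = Y_u`, `X_w + Y_w = X_v + Y_v`, i.e. a corner `(X_u, Y_u), (X_u + δ, Y_u),
(X_u, Y_u + δ)` in `S`; corner-freeness gives `δ = 0` and `u = v = w`.  So the rows are a local
chart-USP and Thm. 37 applies; volumes multiply to `(ab)^{3t}`.

Sources: H. Cohn, R. Kleinberg, B. Szegedy, C. Umans, *Group-theoretic algorithms for matrix
multiplication*, FOCS 2005 = arXiv:math/0511460, §6.2 (Def. 36, Thm. 37).  Not here: the pattern
lemma itself (`stub_chartPattern`), corner-free squares (`stub_cornerFreeSquares`), the count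
(`stub_rowsCount`).
-/

set_option linter.dupNamespace false
-- (single-conjunct summit: the namespace repeats `MatrixMultiplication`)

namespace Summit.MatrixMultiplication.MatrixMultiplication.Theorems.HomocyclicSTPPDesigns.ClusteredCharts

open Literature.Computability.AlgebraicComplexity Finset
open scoped Pointwise

/-- The three elements of `Fin 3`. [folklore] -/
private theorem rowsDesign_fin3 : ∀ r : Fin 3, r = 0 ∨ r = 1 ∨ r = 2 := by decide

/-- The CKSU §6.2 chart over an SDPP family is an `H`-chart: every symbol `(A_i, B_i, {0})`,
`({0}, A_i, B_i)`, `(B_i, {0}, A_i)` has the triple product property, by clause (W) of the SDPP.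
The chart maps are abstract functions on `Fin n × Fin 3` pinned down by their nine values.
[cite: CohnKleinbergSzegedyUmans2005, §6.2] -/
private theorem rowsDesign_isHChart {H : Type*} [AddCommGroup H] [DecidableEq H] {n : ℕ}
    {A B : Fin n → Finset H}
    (hW : ∀ i : Fin n, ∀ a ∈ A i, ∀ a' ∈ A i, ∀ b ∈ B i, ∀ b' ∈ B i,
      (a - a') + (b - b') = 0 → a = a' ∧ b = b')
    {cA cB cC : Fin n × Fin 3 → Finset H}
    (hA0 : ∀ i, cA (i, 0) = A i) (hA1 : ∀ i, cA (i, 1) = {0}) (hA2 : ∀ i, cA (i, 2) = B i)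
    (hB0 : ∀ i, cB (i, 0) = B i) (hB1 : ∀ i, cB (i, 1) = A i) (hB2 : ∀ i, cB (i, 2) = {0})
    (hC0 : ∀ i, cC (i, 0) = {0}) (hC1 : ∀ i, cC (i, 1) = B i) (hC2 : ∀ i, cC (i, 2) = A i) :
    IsHChart cA cB cC := by
  rintro ⟨i, r⟩ a ha a' ha' b hb b' hb' c hc c' hc' h
  rcases rowsDesign_fin3 r with rfl | rfl | rfl
  · rw [hA0] at ha ha'
    rw [hB0] at hb hb'
    rw [hC0, Finset.mem_singleton] at hc hc'
    subst hc hc'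
    have h' : (a' - a) + (b' - b) = 0 := by simpa using h
    obtain ⟨h1, h2⟩ := hW i a' ha' a ha b' hb' b hb h'
    exact ⟨h1.symm, h2.symm, rfl⟩
  · rw [hA1, Finset.mem_singleton] at ha ha'
    rw [hB1] at hb hb'
    rw [hC1] at hc hc'
    subst ha ha'
    have h' : (b' - b) + (c' - c) = 0 := by simpa using h
    obtain ⟨h1, h2⟩ := hW i b' hb' b hb c' hc' c hc h'
    exact ⟨rfl, h1.symm, h2.symm⟩
  · rw [hA2] at ha ha'
    rw [hB2, Finset.mem_singleton] at hb hb'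
    rw [hC2] at hc hc'
    subst hb hb'
    have h' : (c' - c) + (a' - a) = 0 := by
      have : (a' - a) + (c' - c) = 0 := by simpa using h
      rw [add_comm]; exact this
    obtain ⟨h1, h2⟩ := hW i c' hc' c hc a' ha' a ha h'
    exact ⟨h2.symm, rfl, h1.symm⟩

/-- Block volumes: over the CKSU §6.2 chart of a family with `|A_i| = a`, `|B_i| = b`, every
product block of a row of width `k` has `|A'_u| |B'_u| |C'_u| = (ab)^k`.
[cite: CohnKleinbergSzegedyUmans2005, §6.2] -/
private theorem rowsDesign_card_block {H : Type*} [AddCommGroup H] [DecidableEq H] {n : ℕ}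
    {A B : Fin n → Finset H} {a b : ℕ} (hcard : ∀ i, (A i).card = a ∧ (B i).card = b)
    {cA cB cC : Fin n × Fin 3 → Finset H}
    (hA0 : ∀ i, cA (i, 0) = A i) (hA1 : ∀ i, cA (i, 1) = {0}) (hA2 : ∀ i, cA (i, 2) = B i)
    (hB0 : ∀ i, cB (i, 0) = B i) (hB1 : ∀ i, cB (i, 1) = A i) (hB2 : ∀ i, cB (i, 2) = {0})
    (hC0 : ∀ i, cC (i, 0) = {0}) (hC1 : ∀ i, cC (i, 1) = B i) (hC2 : ∀ i, cC (i, 2) = A i)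
    {k L : ℕ} (row : Fin L → Fin k → Fin n × Fin 3) (u : Fin L) :
    (chartBlock cA row u).card * (chartBlock cB row u).card * (chartBlock cC row u).card =
      (a * b) ^ k := by
  have hx : ∀ x : Fin n × Fin 3, (cA x).card * (cB x).card * (cC x).card = a * b := by
    rintro ⟨i, r⟩
    obtain ⟨hA, hB⟩ := hcard i
    rcases rowsDesign_fin3 r with rfl | rfl | rfl
    · rw [hA0, hB0, hC0, hA, hB, Finset.card_singleton, mul_one]
    · rw [hA1, hB1, hC1, hA, hB, Finset.card_singleton, one_mul]
    · rw [hA2, hB2, hC2, hA, hB, Finset.card_singleton, mul_one, mul_comm]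
  simp only [chartBlock, Fintype.card_piFinset]
  rw [← Finset.prod_mul_distrib, ← Finset.prod_mul_distrib]
  rw [Finset.prod_congr rfl fun c _ => hx (row u c)]
  rw [Finset.prod_const, Finset.card_univ, Fintype.card_fin]

/-- One bad coordinate.  If three symbols `(i₁, r), (i₂, r), (i₃, r)` of the same role are NOT a
hyperedge of the CKSU §6.2 chart (i.e. `0` lies in the relation set), then — by the pattern
hypothesis (stub `stub_chartPattern`) and the clustering of difference sets — all three indices
have the same class, and two of them (which two depends on the role) coincide.
[cite: CohnKleinbergSzegedyUmans2005, §6.2] -/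
private theorem rowsDesign_bad_coord {p n m : ℕ} {A B : Fin n → Finset (ZMod p)}
    {cls : Fin n → Fin m}
    (hpat : ∀ t₁ t₂ t₃ : Fin n,
      ((0 : ZMod p) ∈ (A t₁ - A t₂) + (B t₂ - B t₃) + (({0} : Finset (ZMod p)) - {0}) →
          t₁ = t₃ ∧ ¬ Disjoint (A t₁ - B t₁) (A t₂ - B t₂)) ∧
      ((0 : ZMod p) ∈ (({0} : Finset (ZMod p)) - {0}) + (A t₂ - A t₃) + (B t₃ - B t₁) →
          t₂ = t₁ ∧ ¬ Disjoint (A t₂ - B t₂) (A t₃ - B t₃)) ∧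
      ((0 : ZMod p) ∈ (B t₁ - B t₂) + (({0} : Finset (ZMod p)) - {0}) + (A t₃ - A t₁) →
          t₃ = t₂ ∧ ¬ Disjoint (A t₃ - B t₃) (A t₁ - B t₁)))
    (hclust : ∀ i j, cls i ≠ cls j → Disjoint (A i - B i) (A j - B j))
    {cA cB cC : Fin n × Fin 3 → Finset (ZMod p)}
    (hA0 : ∀ i, cA (i, 0) = A i) (hA1 : ∀ i, cA (i, 1) = {0}) (hA2 : ∀ i, cA (i, 2) = B i)
    (hB0 : ∀ i, cB (i, 0) = B i) (hB1 : ∀ i, cB (i, 1) = A i) (hB2 : ∀ i, cB (i, 2) = {0})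
    (hC0 : ∀ i, cC (i, 0) = {0}) (hC1 : ∀ i, cC (i, 1) = B i) (hC2 : ∀ i, cC (i, 2) = A i)
    {r : Fin 3} {i₁ i₂ i₃ : Fin n}
    (h0 : (0 : ZMod p) ∈
      (cA (i₁, r) - cA (i₂, r)) + (cB (i₂, r) - cB (i₃, r)) + (cC (i₃, r) - cC (i₁, r))) :
    cls i₁ = cls i₂ ∧ cls i₂ = cls i₃ ∧ (r = 0 → i₁ = i₃) ∧ (r = 1 → i₂ = i₁) ∧
      (r = 2 → i₃ = i₂) := by
  have hcl : ∀ i j, ¬ Disjoint (A i - B i) (A j - B j) → cls i = cls j := fun i j hij => by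
    by_contra hne
    exact hij (hclust i j hne)
  rcases rowsDesign_fin3 r with rfl | rfl | rfl
  · rw [hA0, hA0, hB0, hB0, hC0, hC0] at h0
    obtain ⟨h13, hnd⟩ := (hpat i₁ i₂ i₃).1 h0
    have h12 := hcl _ _ hnd
    refine ⟨h12, ?_, fun _ => h13, fun h => absurd h (by decide), fun h => absurd h (by decide)⟩
    rw [← h12, h13]
  · rw [hA1, hA1, hB1, hB1, hC1, hC1] at h0
    obtain ⟨h21, hnd⟩ := (hpat i₁ i₂ i₃).2.1 h0
    have h23 := hcl _ _ hnd
    exact ⟨congrArg cls h21.symm, h23, fun h => absurd h (by decide), fun _ => h21,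
      fun h => absurd h (by decide)⟩
  · rw [hA2, hA2, hB2, hB2, hC2, hC2] at h0
    obtain ⟨h32, hnd⟩ := (hpat i₁ i₂ i₃).2.2 h0
    have h31 := hcl _ _ hnd
    refine ⟨?_, congrArg cls h32.symm, fun h => absurd h (by decide),
      fun h => absurd h (by decide), fun _ => h32⟩
    rw [← h31, h32]

/-- The collapse.  Rows indexed by a class word `κ` and a pair `s ∈ S`, coordinate `(r, τ)` carrying
the symbol index `mem (κ (r, τ)) (dig (V r s) τ)` with `V 0 s = s.1`, `V 1 s = s.2`,
`V 2 s = −s.1 − s.2`, `dig` injective (digits) and every `mem c` injective into class `c`: if an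
index triple is bad at EVERY coordinate (in the sense of `rowsDesign_bad_coord`), then the three
class words agree and the three pairs form a corner of `S`, hence coincide when `S` is
corner-free. [cite: CohnKleinbergSzegedyUmans2005, §6.2] -/
private theorem rowsDesign_collapse {t m d n : ℕ} {Z : Type*} [AddCommGroup Z]
    {S : Finset (Z × Z)}
    (hS : ∀ x y δ : Z, (x, y) ∈ S → (x + δ, y) ∈ S → (x + δ, y - δ) ∈ S → δ = 0)
    {dig : Z → Fin t → Fin d} (hdig : Function.Injective dig)
    {cls : Fin n → Fin m} {mem : Fin m → Fin d → Fin n}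
    (hcls : ∀ c j, cls (mem c j) = c) (hmem : ∀ c, Function.Injective (mem c))
    {V : Fin 3 → Z × Z → Z} (hV0 : ∀ s, V 0 s = s.1) (hV1 : ∀ s, V 1 s = s.2)
    (hV2 : ∀ s, V 2 s = -s.1 - s.2)
    {κu κv κw : Fin (3 * t) → Fin m} {su sv sw : Z × Z} (hu : su ∈ S) (hv : sv ∈ S)
    (hw : sw ∈ S)
    (hbad : ∀ (r : Fin 3) (τ : Fin t),
      cls (mem (κu (finProdFinEquiv (r, τ))) (dig (V r su) τ)) =
          cls (mem (κv (finProdFinEquiv (r, τ))) (dig (V r sv) τ)) ∧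
        cls (mem (κv (finProdFinEquiv (r, τ))) (dig (V r sv) τ)) =
          cls (mem (κw (finProdFinEquiv (r, τ))) (dig (V r sw) τ)) ∧
        (r = 0 → mem (κu (finProdFinEquiv (r, τ))) (dig (V r su) τ) =
          mem (κw (finProdFinEquiv (r, τ))) (dig (V r sw) τ)) ∧
        (r = 1 → mem (κv (finProdFinEquiv (r, τ))) (dig (V r sv) τ) =
          mem (κu (finProdFinEquiv (r, τ))) (dig (V r su) τ)) ∧
        (r = 2 → mem (κw (finProdFinEquiv (r, τ))) (dig (V r sw) τ) =
          mem (κv (finProdFinEquiv (r, τ))) (dig (V r sv) τ))) :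
    κu = κv ∧ κv = κw ∧ su = sv ∧ sv = sw := by
  -- the class words agree, coordinate by coordinate
  have hκ : ∀ c, κu c = κv c ∧ κv c = κw c := fun c => by
    obtain ⟨⟨r, τ⟩, rfl⟩ := finProdFinEquiv.surjective c
    obtain ⟨h1, h2, -⟩ := hbad r τ
    simp only [hcls] at h1 h2
    exact ⟨h1, h2⟩
  have huv : κu = κv := funext fun c => (hκ c).1
  have hvw : κv = κw := funext fun c => (hκ c).2
  subst hvw
  subst huv
  -- the values: digits agree on the role blocks
  obtain ⟨xu, yu⟩ := su
  obtain ⟨xv, yv⟩ := sv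
  obtain ⟨xw, yw⟩ := sw
  have hx : xu = xw := by
    refine hdig (funext fun τ => ?_)
    have h := (hbad 0 τ).2.2.1 rfl
    rw [hV0, hV0] at h
    exact hmem _ h
  have hy : yv = yu := by
    refine hdig (funext fun τ => ?_)
    have h := (hbad 1 τ).2.2.2.1 rfl
    rw [hV1, hV1] at h
    exact hmem _ h
  have hz : -xw - yw = -xv - yv := by
    refine hdig (funext fun τ => ?_)
    have h := (hbad 2 τ).2.2.2.2 rfl
    rw [hV2, hV2] at h
    exact hmem _ h
  -- the corner `(xv, yv), (xu, yu) = (xv + δ, yv), (xw, yw) = (xv + δ, yv - δ)` with `δ = xu - xv`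
  have hδ : xu - xv = 0 := by
    refine hS xv yv (xu - xv) hv ?_ ?_
    · have e1 : xv + (xu - xv) = xu := by abel
      rw [e1, hy]
      exact hu
    · have e1 : xv + (xu - xv) = xw := by rw [← hx]; abel
      have e2 : yv - (xu - xv) = yw := by
        have e3 : yw = -(-xw - yw) - xw := by abel
        rw [e3, hz, hy, ← hx]
        abel
      rw [e1, e2]
      exact hw
  have hxuv : xu = xv := sub_eq_zero.1 hδ
  refine ⟨rfl, rfl, Prod.ext hxuv hy.symm, Prod.ext (hxuv.symm.trans hx) ?_⟩
  show yv = yw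
  have e3 : yw = -(-xw - yw) - xw := by abel
  rw [e3, hz, ← hx, hxuv]
  abel

/-- **Rows ⟹ designs** (registered stub `stub_rowsDesign` of line `registered`, clustered-charts
reshape).  Assuming the chart-pattern statement (stub `stub_chartPattern`, the first hypothesis):
for an SDPP family `(A_i, B_i)_{i<n}` in `ℤ/p` with `|A_i| = a`, `|B_i| = b`, a class map
`cls : Fin n → Fin m` with pairwise disjoint difference sets across classes and `≥ d ≥ 1` members per
class, every width `t` and every corner-free `S ⊆ (ℤ/d^t)²` yield an STPP family (tree `IsSTPP`) of
`L ≥ m^{3t}·|S|` triples in `Fin (3t) → ℤ/p` with all block volumes `(ab)^{3t}` — the product blocks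
(CKSU Thm. 37, tree `CohnKleinbergSzegedyUmans2005_thm37`) of the rows described in the module
docstring over the CKSU §6.2 chart. [cite: CohnKleinbergSzegedyUmans2005, §6.2 Def. 36, Thm. 37] -/
theorem stub_rowsDesign :
    (∀ (p n : ℕ) (A B : Fin n → Finset (ZMod p)), IsSDPP A B → ∀ t₁ t₂ t₃ : Fin n,
      ((0 : ZMod p) ∈ (A t₁ - A t₂) + (B t₂ - B t₃) + (({0} : Finset (ZMod p)) - {0}) →
          t₁ = t₃ ∧ ¬ Disjoint (A t₁ - B t₁) (A t₂ - B t₂)) ∧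
      ((0 : ZMod p) ∈ (({0} : Finset (ZMod p)) - {0}) + (A t₂ - A t₃) + (B t₃ - B t₁) →
          t₂ = t₁ ∧ ¬ Disjoint (A t₂ - B t₂) (A t₃ - B t₃)) ∧
      ((0 : ZMod p) ∈ (B t₁ - B t₂) + (({0} : Finset (ZMod p)) - {0}) + (A t₃ - A t₁) →
          t₃ = t₂ ∧ ¬ Disjoint (A t₃ - B t₃) (A t₁ - B t₁))) →
    ∀ (p n m d : ℕ) (A B : Fin n → Finset (ZMod p)) (cls : Fin n → Fin m),
      IsSDPP A B → (∀ i j, cls i ≠ cls j → Disjoint (A i - B i) (A j - B j)) →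
      1 ≤ d → (∀ c : Fin m, d ≤ (Finset.univ.filter fun i => cls i = c).card) →
      ∀ (a b : ℕ), (∀ i, (A i).card = a ∧ (B i).card = b) →
      ∀ (t : ℕ) (S : Finset (ZMod (d ^ t) × ZMod (d ^ t))),
        (∀ x y δ : ZMod (d ^ t), (x, y) ∈ S → (x + δ, y) ∈ S → (x + δ, y - δ) ∈ S → δ = 0) →
        ∃ (L : ℕ) (A' B' C' : Fin L → Finset (Fin (3 * t) → ZMod p)),
          IsSTPP A' B' C' ∧ m ^ (3 * t) * S.card ≤ L ∧
          ∀ u, (A' u).card * (B' u).card * (C' u).card = (a * b) ^ (3 * t) := by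
  intro hpat p n m d A B cls hS hclust hd hdm a b hcard t S hSfree
  haveI : NeZero (d ^ t) := ⟨pow_ne_zero t (by omega)⟩
  -- the chart (CKSU §6.2): role 0 = (A, B, {0}), role 1 = ({0}, A, B), role 2 = (B, {0}, A)
  obtain ⟨cA, hA0, hA1, hA2⟩ : ∃ cA : Fin n × Fin 3 → Finset (ZMod p),
      (∀ i, cA (i, 0) = A i) ∧ (∀ i, cA (i, 1) = {0}) ∧ (∀ i, cA (i, 2) = B i) :=
    ⟨fun x => (![A x.1, {0}, B x.1] : Fin 3 → Finset (ZMod p)) x.2,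
      fun _ => rfl, fun _ => rfl, fun _ => rfl⟩
  obtain ⟨cB, hB0, hB1, hB2⟩ : ∃ cB : Fin n × Fin 3 → Finset (ZMod p),
      (∀ i, cB (i, 0) = B i) ∧ (∀ i, cB (i, 1) = A i) ∧ (∀ i, cB (i, 2) = {0}) :=
    ⟨fun x => (![B x.1, A x.1, {0}] : Fin 3 → Finset (ZMod p)) x.2,
      fun _ => rfl, fun _ => rfl, fun _ => rfl⟩
  obtain ⟨cC, hC0, hC1, hC2⟩ : ∃ cC : Fin n × Fin 3 → Finset (ZMod p),
      (∀ i, cC (i, 0) = {0}) ∧ (∀ i, cC (i, 1) = B i) ∧ (∀ i, cC (i, 2) = A i) :=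
    ⟨fun x => (![{0}, B x.1, A x.1] : Fin 3 → Finset (ZMod p)) x.2,
      fun _ => rfl, fun _ => rfl, fun _ => rfl⟩
  have hChart : IsHChart cA cB cC := rowsDesign_isHChart hS.1 hA0 hA1 hA2 hB0 hB1 hB2 hC0 hC1 hC2
  -- members: `d` distinct indices in every class
  have hmem' : ∀ c : Fin m, ∃ f : Fin d → Fin n, Function.Injective f ∧ ∀ j, cls (f j) = c := by
    intro c
    have hle : Fintype.card (Fin d) ≤ Fintype.card {i : Fin n // cls i = c} := by
      rw [Fintype.card_fin, Fintype.card_subtype]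
      exact hdm c
    obtain ⟨f⟩ := Function.Embedding.nonempty_of_card_le hle
    exact ⟨fun j => (f j).1, fun j j' h => f.injective (Subtype.ext h), fun j => (f j).2⟩
  choose mem hmem_inj hmem_cls using hmem'
  -- digits: `ℤ/d^t ≃ (Fin t → Fin d)`
  have hcardZ : Fintype.card (ZMod (d ^ t)) = Fintype.card (Fin t → Fin d) := by
    rw [ZMod.card, Fintype.card_fun, Fintype.card_fin, Fintype.card_fin]
  obtain ⟨e⟩ : Nonempty (ZMod (d ^ t) ≃ (Fin t → Fin d)) := Fintype.card_eq.1 hcardZ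
  -- values: `V 0 (X, Y) = X`, `V 1 (X, Y) = Y`, `V 2 (X, Y) = -X - Y`
  obtain ⟨V, hV0, hV1, hV2⟩ : ∃ V : Fin 3 → ZMod (d ^ t) × ZMod (d ^ t) → ZMod (d ^ t),
      (∀ s, V 0 s = s.1) ∧ (∀ s, V 1 s = s.2) ∧ (∀ s, V 2 s = -s.1 - s.2) :=
    ⟨fun r s => (![s.1, s.2, -s.1 - s.2] : Fin 3 → ZMod (d ^ t)) r,
      fun _ => rfl, fun _ => rfl, fun _ => rfl⟩
  -- row indices: class words times pairs of `S`
  have hL : Fintype.card ((Fin (3 * t) → Fin m) × ↥S) = m ^ (3 * t) * S.card := by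
    rw [Fintype.card_prod, Fintype.card_fun, Fintype.card_fin, Fintype.card_fin, Fintype.card_coe]
  obtain ⟨eR⟩ : Nonempty (((Fin (3 * t) → Fin m) × ↥S) ≃ Fin (m ^ (3 * t) * S.card)) :=
    ⟨Fintype.equivFinOfCardEq hL⟩
  -- the rows: coordinate `c ↔ (r, τ)` has role `r` and index `mem (κ c) (digit τ of V r s)`
  obtain ⟨row, hrow⟩ : ∃ row : Fin (m ^ (3 * t) * S.card) → Fin (3 * t) → Fin n × Fin 3,
      ∀ u c, row u c =
        (mem ((eR.symm u).1 c)
          (e (V ((finProdFinEquiv.symm c : Fin 3 × Fin t).1) (eR.symm u).2.1)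
            ((finProdFinEquiv.symm c : Fin 3 × Fin t).2)),
         (finProdFinEquiv.symm c : Fin 3 × Fin t).1) :=
    ⟨_, fun _ _ => rfl⟩
  refine ⟨m ^ (3 * t) * S.card, chartBlock cA row, chartBlock cB row, chartBlock cC row,
    CohnKleinbergSzegedyUmans2005_thm37 hChart ?_, le_rfl,
    fun u => rowsDesign_card_block hcard hA0 hA1 hA2 hB0 hB1 hB2 hC0 hC1 hC2 row u⟩
  -- the rows are a local chart-USP
  intro u v w hne
  by_contra hall
  refine hne ?_
  have hall' : ∀ c : Fin (3 * t), (0 : ZMod p) ∈ (cA (row u c) - cA (row v c)) +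
      (cB (row v c) - cB (row w c)) + (cC (row w c) - cC (row u c)) := fun c => by
    by_contra h0
    exact hall ⟨c, (mem_chartHypergraph_iff cA cB cC _ _ _).2 h0⟩
  obtain ⟨h1, h2, h3, h4⟩ := rowsDesign_collapse hSfree e.injective hmem_cls hmem_inj hV0 hV1 hV2
    (κu := (eR.symm u).1) (κv := (eR.symm v).1) (κw := (eR.symm w).1)
    (eR.symm u).2.2 (eR.symm v).2.2 (eR.symm w).2.2 fun r τ => by
      have h := hall' (finProdFinEquiv (r, τ))
      simp only [hrow, Equiv.symm_apply_apply] at h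
      exact rowsDesign_bad_coord (hpat p n A B hS) hclust hA0 hA1 hA2 hB0 hB1 hB2 hC0 hC1 hC2 h
  exact ⟨eR.symm.injective (Prod.ext h1 (Subtype.ext h3)),
    eR.symm.injective (Prod.ext h2 (Subtype.ext h4))⟩

end Summit.MatrixMultiplication.MatrixMultiplication.Theorems.HomocyclicSTPPDesigns.ClusteredCharts
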